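import Mathlib
import HarnessLib

/-!
# Rearrangement tools on `ℝ` for `N`-uniform Gibbs moment bounds

Helper file for the registered stub `stub_gibbsPositionEighthMoment` of line
`bath-bond-deficit-integral`, crux `BondHeatUncertainty.SubdiffusiveBondHeat`
(item `stmt-AtomisticToContinuum-9120`). Pure real analysis, stated for lower Lebesgue integrals of
`ℝ≥0∞`-valued functions on `ℝ` (so that no integrability side conditions arise):

* `ennreal_rearrange` — the two-point rearrangement inequality `A D + B C ≤ A C + B D` for
  `B ≤ A`, `D ≤ C` in `ℝ≥0∞`;
* radially non-increasing functions (`|a| ≤ |b| → f b ≤ f a`; this encodes "even and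
  non-increasing on `[0,∞)`"): values agree at `±a` (`radAnti_eq`), closure under products
  (`radAnti_mul`);
* `lintegral_mul_sub_eq_add_reflect` — the reflection identity: split `∫ f(y) g(x' - y) dy` at the
  midpoint `c = (x + x')/2` and fold the half-line `y > c` onto `y < c` by `y ↦ x + x' - y`;
* `radAnti_lintegral_mul_sub` — **Wintner's lemma**: the convolution
  `x ↦ ∫ f(y) g(x - y) dy` of two radially non-increasing measurable functions is radially
  non-increasing (reflection proof: after folding, the integrand difference is a product of two
  nonnegative differences);
* `chebyshev_lintegral` — **Chebyshev's covariance (sum) inequality**, radial form: for any weight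
  `w`, `h` radially non-decreasing and `g` radially non-increasing,
  `(∫ h g w)(∫ w) ≤ (∫ h w)(∫ g w)` (symmetrise `∫∫ (h(a) - h(b))(g(a) - g(b)) w(a) w(b) ≤ 0`).

All statements are standard and tagged folklore (Wintner 1938, *Asymptotic distributions and
infinite convolutions*, §11; Hardy–Littlewood–Pólya, *Inequalities*, Thm 43 / §10.13).
-/

noncomputable section

open MeasureTheory Set
open scoped ENNReal

namespace Summit.AtomisticToContinuum.FouriersLaw.Theorems.SubdiffusiveBondHeat

/-- Two-point rearrangement inequality in `ℝ≥0∞`: if `B ≤ A` and `D ≤ C` then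
`A D + B C ≤ A C + B D`. [folklore] -/
theorem ennreal_rearrange {A B C D : ℝ≥0∞} (hAB : B ≤ A) (hCD : D ≤ C) :
    A * D + B * C ≤ A * C + B * D := by
  obtain ⟨a, rfl⟩ := exists_add_of_le hAB
  obtain ⟨c, rfl⟩ := exists_add_of_le hCD
  calc (B + a) * D + B * (D + c) = (B + a) * D + B * D + B * c := by ring
    _ ≤ (B + a) * D + B * D + B * c + a * c := le_self_add
    _ = (B + a) * (D + c) + B * D := by ring

/-- A radially non-increasing function takes the same value at two points of equal modulus.
[folklore] -/
theorem radAnti_eq {α : Type*} [PartialOrder α] {f : ℝ → α}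
    (hf : ∀ ⦃a b : ℝ⦄, |a| ≤ |b| → f b ≤ f a) {a b : ℝ} (h : |a| = |b|) : f a = f b :=
  le_antisymm (hf h.symm.le) (hf h.le)

/-- Products of radially non-increasing `ℝ≥0∞`-valued functions are radially non-increasing.
[folklore] -/
theorem radAnti_mul {f g : ℝ → ℝ≥0∞} (hf : ∀ ⦃a b : ℝ⦄, |a| ≤ |b| → f b ≤ f a)
    (hg : ∀ ⦃a b : ℝ⦄, |a| ≤ |b| → g b ≤ g a) :
    ∀ ⦃a b : ℝ⦄, |a| ≤ |b| → f b * g b ≤ f a * g a :=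
  fun _ _ h => mul_le_mul' (hf h) (hg h)

/-- `a ↦ e^{-U(a)/T}` (as an `ℝ≥0∞`-valued function) is radially non-increasing when `U` is
radially non-decreasing and `T ≥ 0`. [folklore] -/
theorem radAnti_ofReal_exp_neg_div {U : ℝ → ℝ} (hU : ∀ ⦃a b : ℝ⦄, |a| ≤ |b| → U a ≤ U b)
    {T : ℝ} (hT : 0 ≤ T) :
    ∀ ⦃a b : ℝ⦄, |a| ≤ |b| →
      ENNReal.ofReal (Real.exp (-U b / T)) ≤ ENNReal.ofReal (Real.exp (-U a / T)) := by
  intro a b h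
  refine ENNReal.ofReal_le_ofReal (Real.exp_le_exp.mpr ?_)
  exact div_le_div_of_nonneg_right (neg_le_neg (hU h)) hT

/-- **Reflection identity.** For measurable `f, g : ℝ → ℝ≥0∞` and `x x' : ℝ` with midpoint
`c = (x + x')/2`:
`∫ f(y) g(x' - y) dy = ∫ (𝟙[y ≤ c] f(y) g(x' - y) + 𝟙[y < c] f(x + x' - y) g(y - x)) dy`
(split the line at `c` and substitute `y ↦ x + x' - y` on the upper half). [folklore] -/
theorem lintegral_mul_sub_eq_add_reflect {f g : ℝ → ℝ≥0∞} (hf : Measurable f)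
    (hg : Measurable g) (x x' : ℝ) :
    ∫⁻ y, f y * g (x' - y) =
      ∫⁻ y, ((Iic ((x + x') / 2)).indicator (fun y => f y * g (x' - y)) y +
        (Iio ((x + x') / 2)).indicator (fun y => f (x + x' - y) * g (y - x)) y) := by
  set c := (x + x') / 2 with hc
  have hφ : Measurable fun y => f y * g (x' - y) :=
    hf.mul (hg.comp (measurable_const.sub measurable_id))
  have hI : Measurable fun y => (Iic c).indicator (fun y => f y * g (x' - y)) y :=
    hφ.indicator measurableSet_Iic
  calc ∫⁻ y, f y * g (x' - y)
      = ∫⁻ y, ((Iic c).indicator (fun y => f y * g (x' - y)) y +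
          (Ioi c).indicator (fun y => f y * g (x' - y)) y) := by
        refine lintegral_congr fun y => ?_
        rw [← Set.compl_Iic, Set.indicator_self_add_compl_apply]
    _ = (∫⁻ y, (Iic c).indicator (fun y => f y * g (x' - y)) y) +
          ∫⁻ y, (Ioi c).indicator (fun y => f y * g (x' - y)) y := lintegral_add_left hI _
    _ = (∫⁻ y, (Iic c).indicator (fun y => f y * g (x' - y)) y) +
          ∫⁻ y, (Iio c).indicator (fun y => f (x + x' - y) * g (y - x)) y := by
        congr 1
        rw [← lintegral_sub_left_eq_self
          (fun y => (Ioi c).indicator (fun y => f y * g (x' - y)) y) (x + x')]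
        refine lintegral_congr fun y => ?_
        have h1 : x + x' - y ∈ Ioi c ↔ y ∈ Iio c := by
          simp only [mem_Ioi, mem_Iio, hc]
          constructor <;> intro h <;> linarith
        by_cases hy : y ∈ Iio c
        · rw [indicator_of_mem (h1.mpr hy), indicator_of_mem hy]
          congr 2
          ring
        · rw [indicator_of_notMem (mt h1.mp hy), indicator_of_notMem hy]
    _ = _ := (lintegral_add_left hI _).symm

/-- **Wintner's lemma** (lower-Lebesgue-integral form): the convolution
`x ↦ ∫ f(y) g(x - y) dy` of two radially non-increasing measurable functions `ℝ → ℝ≥0∞` is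
radially non-increasing. [folklore] -/
theorem radAnti_lintegral_mul_sub {f g : ℝ → ℝ≥0∞} (hf : Measurable f) (hg : Measurable g)
    (hfa : ∀ ⦃a b : ℝ⦄, |a| ≤ |b| → f b ≤ f a) (hga : ∀ ⦃a b : ℝ⦄, |a| ≤ |b| → g b ≤ g a) :
    ∀ ⦃a b : ℝ⦄, |a| ≤ |b| → (∫⁻ y, f y * g (b - y)) ≤ ∫⁻ y, f y * g (a - y) := by
  -- evenness of the convolution
  have heven : ∀ x : ℝ, (∫⁻ y, f y * g (-x - y)) = ∫⁻ y, f y * g (x - y) := by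
    intro x
    rw [← lintegral_neg_eq_self (fun y => f y * g (-x - y))]
    refine lintegral_congr fun y => ?_
    rw [radAnti_eq hfa (abs_neg y)]
    congr 1
    exact radAnti_eq hga (by rw [show -x - -y = -(x - y) by ring, abs_neg])
  have habs : ∀ x : ℝ, (∫⁻ y, f y * g (|x| - y)) = ∫⁻ y, f y * g (x - y) := by
    intro x
    rcases abs_choice x with h | h
    · rw [h]
    · rw [h, heven]
  -- monotonicity on `[0, ∞)` by reflection
  have hmono : ∀ x x' : ℝ, 0 ≤ x → x ≤ x' →
      (∫⁻ y, f y * g (x' - y)) ≤ ∫⁻ y, f y * g (x - y) := by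
    intro x x' hx hxx'
    rw [lintegral_mul_sub_eq_add_reflect hf hg x x', lintegral_mul_sub_eq_add_reflect hf hg x' x,
      add_comm x' x]
    refine lintegral_mono fun y => ?_
    set c := (x + x') / 2 with hc
    rcases lt_trichotomy y c with hy | hy | hy
    · -- `y < c`: two-point rearrangement
      rw [indicator_of_mem (mem_Iic.mpr hy.le), indicator_of_mem (mem_Iio.mpr hy),
        indicator_of_mem (mem_Iic.mpr hy.le), indicator_of_mem (mem_Iio.mpr hy),
        radAnti_eq hga (abs_sub_comm y x), radAnti_eq hga (abs_sub_comm y x')]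
      have hyy : |y| ≤ |x + x' - y| := by
        rw [abs_le]
        have h2 : c < x + x' - y := by rw [hc] at hy ⊢; linarith
        have h3 : 0 ≤ x + x' - y := by linarith [show 0 ≤ c from by rw [hc]; linarith]
        rw [abs_of_nonneg h3]
        constructor <;> linarith
      have hxy : |x - y| ≤ |x' - y| := by
        rw [abs_le]
        have h4 : x' - y ≤ |x' - y| := le_abs_self _
        constructor <;> [skip; linarith]
        rw [hc] at hy
        linarith
      exact ennreal_rearrange (hfa hyy) (hga hxy)
    · -- `y = c`: the reflected terms vanish, the direct terms agree
      subst hy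
      rw [indicator_of_mem (mem_Iic.mpr le_rfl), indicator_of_mem (mem_Iic.mpr le_rfl),
        indicator_of_notMem (fun h => lt_irrefl _ (mem_Iio.mp h)),
        indicator_of_notMem (fun h => lt_irrefl _ (mem_Iio.mp h)),
        radAnti_eq hga (show |x' - c| = |x - c| by
          rw [hc, show x' - (x + x') / 2 = -(x - (x + x') / 2) by ring, abs_neg])]
    · -- `y > c`: everything vanishes
      rw [indicator_of_notMem (fun h => not_le.mpr hy (mem_Iic.mp h)),
        indicator_of_notMem (fun h => lt_asymm hy (mem_Iio.mp h)),
        indicator_of_notMem (fun h => not_le.mpr hy (mem_Iic.mp h)),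
        indicator_of_notMem (fun h => lt_asymm hy (mem_Iio.mp h))]
  intro a b hab
  rw [← habs a, ← habs b]
  exact hmono |a| |b| (abs_nonneg a) hab


/-- **Chebyshev's covariance (sum) inequality**, radial form, for lower Lebesgue integrals on `ℝ`:
for measurable `w, h, g : ℝ → ℝ≥0∞` with `h` radially non-decreasing and `g` radially
non-increasing, `(∫ h g w)(∫ w) ≤ (∫ h w)(∫ g w)`. Proof: both sides doubled are double
integrals against `w(a) w(b) da db` of `h(a)g(a) + h(b)g(b)` resp. `h(a)g(b) + h(b)g(a)`, and the
former integrand is pointwise the smaller (two-point rearrangement, comparing `|a|` with `|b|`).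
[folklore] -/
theorem chebyshev_lintegral :
    ∀ {w h g : ℝ → ENNReal}, Measurable w → Measurable h → Measurable g →
      (∀ ⦃a b : ℝ⦄, |a| ≤ |b| → h a ≤ h b) → (∀ ⦃a b : ℝ⦄, |a| ≤ |b| → g b ≤ g a) →
      (∫⁻ a, h a * g a * w a) * (∫⁻ a, w a) ≤ (∫⁻ a, h a * w a) * ∫⁻ a, g a * w a := by
  intro w h g hw hh hg hhm hga
  -- pointwise two-point inequality
  have key : ∀ a b : ℝ, h a * g a * w a * w b + w a * (h b * g b * w b) ≤
      h a * w a * (g b * w b) + g a * w a * (h b * w b) := by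
    intro a b
    have hr : h a * g a + h b * g b ≤ h a * g b + h b * g a := by
      rcases le_total |a| |b| with hab | hab
      · calc h a * g a + h b * g b = h b * g b + h a * g a := add_comm _ _
          _ ≤ h b * g a + h a * g b := ennreal_rearrange (hhm hab) (hga hab)
          _ = h a * g b + h b * g a := add_comm _ _
      · exact ennreal_rearrange (hhm hab) (hga hab)
    calc h a * g a * w a * w b + w a * (h b * g b * w b)
        = (h a * g a + h b * g b) * (w a * w b) := by ring
      _ ≤ (h a * g b + h b * g a) * (w a * w b) := mul_le_mul_left hr _
      _ = h a * w a * (g b * w b) + g a * w a * (h b * w b) := by ring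
  -- measurability bookkeeping
  have hhgw : Measurable fun a => h a * g a * w a := (hh.mul hg).mul hw
  have hhw : Measurable fun a => h a * w a := hh.mul hw
  have hgw : Measurable fun a => g a * w a := hg.mul hw
  have m1 : Measurable fun p : ℝ × ℝ => h p.1 * g p.1 * w p.1 * w p.2 :=
    (hhgw.comp measurable_fst).mul (hw.comp measurable_snd)
  have m2 : Measurable fun p : ℝ × ℝ => h p.1 * w p.1 * (g p.2 * w p.2) :=
    (hhw.comp measurable_fst).mul (hgw.comp measurable_snd)
  -- the doubled sides as double integrals
  have hL : (∫⁻ a, h a * g a * w a) * (∫⁻ a, w a) + (∫⁻ a, h a * g a * w a) * (∫⁻ a, w a) =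
      ∫⁻ a, ∫⁻ b, (h a * g a * w a * w b + w a * (h b * g b * w b)) := by
    have e1 : (∫⁻ a, h a * g a * w a) * (∫⁻ a, w a) = ∫⁻ a, ∫⁻ b, h a * g a * w a * w b :=
      (lintegral_lintegral_mul hhgw.aemeasurable hw.aemeasurable).symm
    have e2 : (∫⁻ a, h a * g a * w a) * (∫⁻ a, w a) = ∫⁻ a, ∫⁻ b, w a * (h b * g b * w b) := by
      rw [mul_comm]
      exact (lintegral_lintegral_mul hw.aemeasurable hhgw.aemeasurable).symm
    nth_rewrite 1 [e1]
    rw [e2, ← lintegral_add_left m1.lintegral_prod_right']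
    refine lintegral_congr fun a => ?_
    exact (lintegral_add_left (m1.comp measurable_prodMk_left) _).symm
  have hR : (∫⁻ a, h a * w a) * (∫⁻ a, g a * w a) + (∫⁻ a, h a * w a) * (∫⁻ a, g a * w a) =
      ∫⁻ a, ∫⁻ b, (h a * w a * (g b * w b) + g a * w a * (h b * w b)) := by
    have e1 : (∫⁻ a, h a * w a) * (∫⁻ a, g a * w a) = ∫⁻ a, ∫⁻ b, h a * w a * (g b * w b) :=
      (lintegral_lintegral_mul hhw.aemeasurable hgw.aemeasurable).symm
    have e2 : (∫⁻ a, h a * w a) * (∫⁻ a, g a * w a) = ∫⁻ a, ∫⁻ b, g a * w a * (h b * w b) := by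
      rw [mul_comm]
      exact (lintegral_lintegral_mul hgw.aemeasurable hhw.aemeasurable).symm
    nth_rewrite 1 [e1]
    rw [e2, ← lintegral_add_left m2.lintegral_prod_right']
    refine lintegral_congr fun a => ?_
    exact (lintegral_add_left (m2.comp measurable_prodMk_left) _).symm
  have h2 : 2 * ((∫⁻ a, h a * g a * w a) * ∫⁻ a, w a) ≤
      2 * ((∫⁻ a, h a * w a) * ∫⁻ a, g a * w a) := by
    rw [two_mul, two_mul, hL, hR]
    exact lintegral_mono fun a => lintegral_mono fun b => key a b
  exact (ENNReal.mul_le_mul_iff_right two_ne_zero ENNReal.ofNat_ne_top).mp h2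

end Summit.AtomisticToContinuum.FouriersLaw.Theorems.SubdiffusiveBondHeat
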